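import Mathlib
import Summits.Parity.GeneralizedHardyLittlewood.Theorems.FordMaynardSieveConst01651SieveConst01651Defs
import Summits.Parity.GeneralizedHardyLittlewood.Theorems.FordMaynardSieveConst01651SieveConst01651HkPieces

/-!
# Route `FordMaynardSieveConst01651`, target `SieveConst01651` (stmt-Parity-19185), line `sieve_decomposition`:
# the registered stub `stub_hkPieces` BY NAME

Skeleton `Cruxes/SieveConst01651/Lines/sieve_decomposition.lean` v20 (sha16 `ce303863863cc0ea`), stub 1a′
`stub_hkPieces` (M−, pure convex geometry of the cone data): for `Admissible ν g` and all `k m`, the main-term weight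
`hfun ν g k m` (K. Ford, J. Maynard, arXiv:2407.14368, proof of Lemma 7.20 in the §6.2 form) is an EXACT finite sum of
constants times indicators of convex measurable sets.  Content: `starSum_box_pieces` (`…SieveConst01651HkPieces`,
stable-sorting chambers); here only the case split `m = k` / `m ≠ k` over the definitions of `…SieveConst01651Defs`
(VERBATIM the skeleton's `hfun` / `Admissible`).  Closing one stub of one line; nothing here proves the Parity summit.
-/

noncomputable section

open Finset MeasureTheory Set
open scoped Classical
open Literature.NumberTheory.Sieve Literature.NumberTheory.Sieve.FordMaynard

namespace Summit.Parity.GeneralizedHardyLittlewood.FordMaynardSieveConst01651SieveConst01651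

/-- **Registered stub `stub_hkPieces`** (line `sieve_decomposition`, stmt-Parity-19185), VERBATIM: in every dimension
`m`, `h_k = hfun ν g k m` is an exact finite sum `∑ⱼ cⱼ·𝟙[Pcⱼ]` with convex measurable `Pcⱼ` (for `m = k` by
`starSum_box_pieces`; for `m ≠ k` the empty sum). [cite: FordMaynard2024PrimeSieves, Lemma 7.20 and §6.2] -/
theorem stub_hkPieces :
    ∀ ν : ℝ, 0 < ν → ν < 1 / 4 → ∀ g : VecFn, Admissible ν g → ∀ k m : ℕ,
      ∃ (n : ℕ) (Pc : Fin n → Set (Fin m → ℝ)) (c : Fin n → ℝ),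
        (∀ j, Convex ℝ (Pc j) ∧ MeasurableSet (Pc j)) ∧
        ∀ v, hfun ν g k m v = ∑ j, if v ∈ Pc j then c j else 0 := by
  intro ν _ _ g hadm k m
  by_cases hmk : m = k
  · obtain ⟨n, Pc, c, hPc, h⟩ := starSum_box_pieces hadm.1 hadm.2.1 ν m
    refine ⟨n, Pc, c, hPc, fun v => ?_⟩
    rw [← h v, hfun_apply]
    simp only [hmk, true_and]
  · exact ⟨0, Fin.elim0, Fin.elim0, fun j => j.elim0, fun v => by rw [hfun_of_ne hmk]; simp⟩

end Summit.Parity.GeneralizedHardyLittlewood.FordMaynardSieveConst01651SieveConst01651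

end
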